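import Summits.Ventures.Crystal3D.Theorems.StickyWulffConstantCoaxialWallLawChainCyclic
import HarnessLib

/-!
# CHAIN TORSION: the level-⅓ part of one grain's reach group is EXACTLY the two fault cosets of the two `{111}` planes
# through the steep slot — so every other level-⅓ translation pair is free (crux `CoaxialWallLaw`, stmt-Ventures-19481,
# line `WallLedgerF`)

HONEST FRAMING. Venture `Summits/Ventures/Crystal3D` (cell `crystal3d-full`), helper `--supports` the crux `CoaxialWallLaw`
of `route-Ventures-StickyWulffConstant` (REGISTERED line `WallLedgerF`, open stub `stub_coaxialTwoSlabAdhesion`).  Rung credit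
only; F-C1 not moved; NOT the stub: `ExactOnly`(C12-55) [E1] and `StarPairFar` [certified; kernel at computational grade] stay BY
NAME, and the two REGISTERED level-⅓ cosets per steep slot (the stacking-fault translations of the two planes through it)
remain the census.

THE THEOREM.  Fix a frame `A`, a slot `u` and a unit menu normal `n₁` of `A` with `⟪A u, n₁⟫ = √(2/3)`; the only other such
normal is `n₂ = 2√(2/3)·A u − n₁` (`menu_normal_eq_or_eq_twin`), `⟪n₁, n₂⟫ = ⅓`.  By `…ChainCyclic` each of the two forced rays
over `(A, u)` has a CYCLIC registry `M + ℤ gⁱ_K` (`M = A·Λ₀`, `gⁱ_K = √(2/3)·νⁱ_K`) with `3 gⁱ_{K+1} ≡ (12β+5) gⁱ_K`.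
* `two_chain_torsion` — JOINT exact order: `a·g¹_K + b·g²_K ∈ M ⇒ 3^{K+1} ∣ a, b` (base: pair with `n₁`, `n₂`; step: the
  recursion, `12β+5` prime to `3`);
* `reachGroup_chainFrames_subset_two_chains` — every `v ∈ reachGroup (chainFrames z A u)` lies in `M + ℤg¹_K + ℤg²_K` for
  some `K` (the chain frames are `A` and the frames of the two rays);
* **`reachGroup_chainFrames_torsion`** — if moreover `3v ∈ M` then `v ∈ M + ℤ·√(2/3)n₁ + ℤ·√(2/3)n₂`: THE LEVEL-⅓ PART OF ONE
  GRAIN'S REACH GROUP IS `Λ₀ + ℤb_{n₁} + ℤb_{n₂}` (9 of the 27 cosets of `⅓Λ₀/Λ₀`);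
* the LEDGER consequences (one-sided non-arrival, `TwoSlabLedgerAt (½κ₁)`, lane F's stub conclusion verbatim for every
  level-⅓ translation pair outside the two cosets) are in the sequel `…CoaxialWallLawChainTorsionLedger`.
READING (exact numerics calc/reach*.py agree: 562/562 (z,u) pairs).  Of the 26 non-trivial level-⅓ translation classes
`A₁(y/3) + Λ`, `y ∈ Λ₀`, a class is registered for the steep slot `u = ε_i e_i + ε_j e_j` iff `ε_i y_i ≡ ε_j y_j (mod 3)`;
with two steep slots of different supports (every wall within the 3- or 2-steep-slot cone of a `{111}` axis) only the two
BASAL stacking-fault classes `±b` survive: the inclined-plane faults, all two-partial classes `⅓·slot` and all `⅓·⟨200⟩`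
classes are FREE at `½κ₁` for arbitrary fillings.
WHAT THIS IS NOT: not the stub (the basal-fault staircase and coherent twins remain); F-C1 not moved.
-/

noncomputable section

namespace Summit.Ventures.Crystal3D.Theorems

open Summit.Ventures.Crystal3D Finset
open Literature.MathematicalPhysics.StatisticalMechanics (fccStacking barlowStacking IsHaggSeq contactDeficiency)
open scoped InnerProductSpace

/-! ### The second normal through the slot -/

/-- The two `{111}` normals through a positive slot meet at `⅓`. -/
theorem inner_normal_mirror_slot (A : EuclideanSpace ℝ (Fin 3) ≃ₗᵢ[ℝ] EuclideanSpace ℝ (Fin 3)) {u n₁ : EuclideanSpace ℝ (Fin 3)}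
    (hn₁ : ‖n₁‖ = 1) (hun : ⟪A u, n₁⟫_ℝ = Real.sqrt (2 / 3)) :
    ⟪n₁, (2 * Real.sqrt (2 / 3)) • A u - n₁⟫_ℝ = 1 / 3 := by
  have h23 : Real.sqrt (2 / 3) * Real.sqrt (2 / 3) = 2 / 3 := Real.mul_self_sqrt (by norm_num)
  rw [inner_sub_right, inner_smul_right, real_inner_comm, hun, real_inner_self_eq_norm_sq, hn₁]
  nlinarith [h23]

/-- `12β + 5` is prime to every power of `3`. -/
theorem isCoprime_three_pow_twelve_add_five (β : ℤ) (m : ℕ) : IsCoprime ((3 : ℤ) ^ m) (12 * β + 5) :=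
  (show IsCoprime (3 : ℤ) (12 * β + 5) from ⟨4 * β + 2, -1, by ring⟩).pow_left

/-! ### Joint exact order of the two chains -/

/-- **Base**: `a·√(2/3)n₁ + b·√(2/3)n₂ ∈ A·Λ₀ ⇒ 3 ∣ a ∧ 3 ∣ b` (pair with the menu normals `n₁`, `n₂`; `⟪n₁,n₂⟫ = ⅓`). -/
theorem two_normal_torsion_base (A : EuclideanSpace ℝ (Fin 3) ≃ₗᵢ[ℝ] EuclideanSpace ℝ (Fin 3))
    {u n₁ : EuclideanSpace ℝ (Fin 3)} (hu : u ∈ fccSlots) (hn₁ : ‖n₁‖ = 1)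
    (hmenu₁ : ∀ w ∈ fccSlots, ⟪A w, n₁⟫_ℝ = 0 ∨ ⟪A w, n₁⟫_ℝ = Real.sqrt (2 / 3) ∨ ⟪A w, n₁⟫_ℝ = -Real.sqrt (2 / 3))
    (hun : ⟪A u, n₁⟫_ℝ = Real.sqrt (2 / 3)) {a b : ℤ}
    (h : A.symm ((a : ℝ) • (Real.sqrt (2 / 3) • n₁) + (b : ℝ) • (Real.sqrt (2 / 3) • ((2 * Real.sqrt (2 / 3)) • A u - n₁))) ∈
      fccStacking 1 (Real.sqrt (2 / 3))) :
    (3 : ℤ) ∣ a ∧ (3 : ℤ) ∣ b := by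
  set n₂ : EuclideanSpace ℝ (Fin 3) := (2 * Real.sqrt (2 / 3)) • A u - n₁ with hn₂
  have hr : Real.sqrt (2 / 3) ≠ 0 := by positivity
  have h12 : ⟪n₁, n₂⟫_ℝ = 1 / 3 := inner_normal_mirror_slot A hn₁ hun
  have hn₂u : ‖n₂‖ = 1 := norm_mirror_slot A hn₁ hu hun
  have hmenu₂ : ∀ w ∈ fccSlots, ⟪A w, n₂⟫_ℝ = 0 ∨ ⟪A w, n₂⟫_ℝ = Real.sqrt (2 / 3) ∨ ⟪A w, n₂⟫_ℝ = -Real.sqrt (2 / 3) :=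
    menu_mirror_slot A hmenu₁ hu hun
  have n11 : ⟪n₁, n₁⟫_ℝ = 1 := by rw [real_inner_self_eq_norm_sq, hn₁, one_pow]
  have n22 : ⟪n₂, n₂⟫_ℝ = 1 := by rw [real_inner_self_eq_norm_sq, hn₂u, one_pow]
  have n21 : ⟪n₂, n₁⟫_ℝ = 1 / 3 := by rw [real_inner_comm, h12]
  obtain ⟨j₁, hj₁⟩ := inner_lattice_menu A hmenu₁ h
  obtain ⟨j₂, hj₂⟩ := inner_lattice_menu A hmenu₂ h
  rw [LinearIsometryEquiv.apply_symm_apply, inner_add_left, inner_smul_left, inner_smul_left, inner_smul_left,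
    inner_smul_left] at hj₁ hj₂
  simp only [conj_trivial] at hj₁ hj₂
  rw [n11, n21] at hj₁
  rw [h12, n22] at hj₂
  have e₁ : ((3 * a + b : ℤ) : ℝ) = ((3 * j₁ : ℤ) : ℝ) := by
    push_cast
    have := mul_right_cancel₀ hr (show (a + b * (1 / 3)) * Real.sqrt (2 / 3) = j₁ * Real.sqrt (2 / 3) by linarith)
    linarith
  have e₂ : ((a + 3 * b : ℤ) : ℝ) = ((3 * j₂ : ℤ) : ℝ) := by
    push_cast
    have := mul_right_cancel₀ hr (show (a * (1 / 3) + b) * Real.sqrt (2 / 3) = j₂ * Real.sqrt (2 / 3) by linarith)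
    linarith
  have i₁ : 3 * a + b = 3 * j₁ := by exact_mod_cast e₁
  have i₂ : a + 3 * b = 3 * j₂ := by exact_mod_cast e₂
  exact ⟨⟨j₂ - b, by linarith⟩, ⟨j₁ - a, by linarith⟩⟩

/-- **Joint exact order along the two forced rays through `u`**: `a·g¹_K + b·g²_K ∈ A·Λ₀ ⇒ 3^{K+1} ∣ a ∧ 3^{K+1} ∣ b`. -/
theorem two_chain_torsion (z : EuclideanSpace ℝ (Fin 3)) (A : EuclideanSpace ℝ (Fin 3) ≃ₗᵢ[ℝ] EuclideanSpace ℝ (Fin 3))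
    {u n₁ : EuclideanSpace ℝ (Fin 3)} (hu : u ∈ fccSlots) (hn₁ : ‖n₁‖ = 1)
    (hmenu₁ : ∀ w ∈ fccSlots, ⟪A w, n₁⟫_ℝ = 0 ∨ ⟪A w, n₁⟫_ℝ = Real.sqrt (2 / 3) ∨ ⟪A w, n₁⟫_ℝ = -Real.sqrt (2 / 3))
    (hun : ⟪A u, n₁⟫_ℝ = Real.sqrt (2 / 3)) (K : ℕ) :
    ∀ a b : ℤ, A.symm ((a : ℝ) • (Real.sqrt (2 / 3) • (forcedTop z ⟨A, u, 0⟩ n₁ K).nrm) +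
        (b : ℝ) • (Real.sqrt (2 / 3) • (forcedTop z ⟨A, u, 0⟩ ((2 * Real.sqrt (2 / 3)) • A u - n₁) K).nrm)) ∈
        fccStacking 1 (Real.sqrt (2 / 3)) →
      ((3 : ℤ) ^ (K + 1)) ∣ a ∧ ((3 : ℤ) ^ (K + 1)) ∣ b := by
  set n₂ : EuclideanSpace ℝ (Fin 3) := (2 * Real.sqrt (2 / 3)) • A u - n₁ with hn₂
  have hn₂u : ‖n₂‖ = 1 := norm_mirror_slot A hn₁ hu hun
  have hmenu₂ : ∀ w ∈ fccSlots, ⟪A w, n₂⟫_ℝ = 0 ∨ ⟪A w, n₂⟫_ℝ = Real.sqrt (2 / 3) ∨ ⟪A w, n₂⟫_ℝ = -Real.sqrt (2 / 3) :=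
    menu_mirror_slot A hmenu₁ hu hun
  induction K with
  | zero =>
    intro a b h
    have e1 : (forcedTop z ⟨A, u, 0⟩ n₁ 0).nrm = n₁ := rfl
    have e2 : (forcedTop z ⟨A, u, 0⟩ n₂ 0).nrm = n₂ := rfl
    rw [e1, e2] at h
    simpa using two_normal_torsion_base A hu hn₁ hmenu₁ hun h
  | succ K ih =>
    intro a b h
    obtain ⟨⟨β₁, hβ₁⟩, -⟩ := forcedTop_chain_recursion z A u hn₁ hmenu₁ K
    obtain ⟨⟨β₂, hβ₂⟩, -⟩ := forcedTop_chain_recursion z A u hn₂u hmenu₂ K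
    set G₁ := Real.sqrt (2 / 3) • (forcedTop z ⟨A, u, 0⟩ n₁ (K + 1)).nrm with hG₁
    set G₂ := Real.sqrt (2 / 3) • (forcedTop z ⟨A, u, 0⟩ n₂ (K + 1)).nrm with hG₂
    set g₁ := Real.sqrt (2 / 3) • (forcedTop z ⟨A, u, 0⟩ n₁ K).nrm with hg₁
    set g₂ := Real.sqrt (2 / 3) • (forcedTop z ⟨A, u, 0⟩ n₂ K).nrm with hg₂
    -- `3(aG₁ + bG₂) = a(3G₁ − c₁g₁) + b(3G₂ − c₂g₂) + (ac₁ g₁ + bc₂ g₂)`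
    have hsum : A.symm (((a * (12 * β₁ + 5) : ℤ) : ℝ) • g₁ + ((b * (12 * β₂ + 5) : ℤ) : ℝ) • g₂) ∈
        fccStacking 1 (Real.sqrt (2 / 3)) := by
      have e : ((a * (12 * β₁ + 5) : ℤ) : ℝ) • g₁ + ((b * (12 * β₂ + 5) : ℤ) : ℝ) • g₂ =
          ((3 : ℤ) : ℝ) • ((a : ℝ) • G₁ + (b : ℝ) • G₂) -
          ((a : ℝ) • ((3 : ℝ) • G₁ - ((12 * β₁ + 5 : ℤ) : ℝ) • g₁) +
            (b : ℝ) • ((3 : ℝ) • G₂ - ((12 * β₂ + 5 : ℤ) : ℝ) • g₂)) := by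
        push_cast; module
      rw [e]
      exact symm_mem_fcc_sub A (symm_mem_fcc_zsmul A 3 h)
        (symm_mem_fcc_add A (symm_mem_fcc_zsmul A a hβ₁) (symm_mem_fcc_zsmul A b hβ₂))
    obtain ⟨ha, hb⟩ := ih _ _ hsum
    have ha' : ((3 : ℤ) ^ (K + 1)) ∣ a := (isCoprime_three_pow_twelve_add_five β₁ (K + 1)).dvd_of_dvd_mul_right ha
    have hb' : ((3 : ℤ) ^ (K + 1)) ∣ b := (isCoprime_three_pow_twelve_add_five β₂ (K + 1)).dvd_of_dvd_mul_right hb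
    obtain ⟨a', rfl⟩ := ha'
    obtain ⟨b', rfl⟩ := hb'
    -- `3^{K+1}a' G₁ = a' 3^K (3 G₁) = a'3^K (c₁ g₁ + μ₁)`
    have hsum' : A.symm (((3 ^ K * a' * (12 * β₁ + 5) : ℤ) : ℝ) • g₁ + ((3 ^ K * b' * (12 * β₂ + 5) : ℤ) : ℝ) • g₂) ∈
        fccStacking 1 (Real.sqrt (2 / 3)) := by
      have e : ((3 ^ K * a' * (12 * β₁ + 5) : ℤ) : ℝ) • g₁ + ((3 ^ K * b' * (12 * β₂ + 5) : ℤ) : ℝ) • g₂ =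
          ((((3 : ℤ) ^ (K + 1) * a' : ℤ) : ℝ) • G₁ + (((3 : ℤ) ^ (K + 1) * b' : ℤ) : ℝ) • G₂) -
          (((3 ^ K * a' : ℤ) : ℝ) • ((3 : ℝ) • G₁ - ((12 * β₁ + 5 : ℤ) : ℝ) • g₁) +
            ((3 ^ K * b' : ℤ) : ℝ) • ((3 : ℝ) • G₂ - ((12 * β₂ + 5 : ℤ) : ℝ) • g₂)) := by
        push_cast; module
      rw [e]
      exact symm_mem_fcc_sub A h
        (symm_mem_fcc_add A (symm_mem_fcc_zsmul A _ hβ₁) (symm_mem_fcc_zsmul A _ hβ₂))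
    obtain ⟨ha2, hb2⟩ := ih _ _ hsum'
    have h3a : (3 : ℤ) ∣ a' := by
      have h1 : ((3 : ℤ) ^ (K + 1)) ∣ 3 ^ K * (a' * (12 * β₁ + 5)) := by rw [← mul_assoc]; exact ha2
      rw [pow_succ] at h1
      have h2 : (3 : ℤ) ∣ a' * (12 * β₁ + 5) := (mul_dvd_mul_iff_left (pow_ne_zero K (by norm_num))).1 h1
      exact (isCoprime_three_pow_twelve_add_five β₁ 1 |>.dvd_of_dvd_mul_right (by simpa using h2))
    have h3b : (3 : ℤ) ∣ b' := by
      have h1 : ((3 : ℤ) ^ (K + 1)) ∣ 3 ^ K * (b' * (12 * β₂ + 5)) := by rw [← mul_assoc]; exact hb2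
      rw [pow_succ] at h1
      have h2 : (3 : ℤ) ∣ b' * (12 * β₂ + 5) := (mul_dvd_mul_iff_left (pow_ne_zero K (by norm_num))).1 h1
      exact (isCoprime_three_pow_twelve_add_five β₂ 1 |>.dvd_of_dvd_mul_right (by simpa using h2))
    obtain ⟨a'', rfl⟩ := h3a
    obtain ⟨b'', rfl⟩ := h3b
    exact ⟨⟨a'', by ring⟩, ⟨b'', by ring⟩⟩

/-! ### Lifting along a ray and the two-chain envelope of the reach group -/

/-- Along a ray, `g_K ∈ M + ℤ g_{K'}` for `K ≤ K'`. -/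
theorem forcedTop_nrm_lift (z : EuclideanSpace ℝ (Fin 3)) (A : EuclideanSpace ℝ (Fin 3) ≃ₗᵢ[ℝ] EuclideanSpace ℝ (Fin 3))
    (u : EuclideanSpace ℝ (Fin 3)) {n : EuclideanSpace ℝ (Fin 3)} (hn : ‖n‖ = 1)
    (hmenu : ∀ w ∈ fccSlots, ⟪A w, n⟫_ℝ = 0 ∨ ⟪A w, n⟫_ℝ = Real.sqrt (2 / 3) ∨ ⟪A w, n⟫_ℝ = -Real.sqrt (2 / 3))
    {K K' : ℕ} (hKK : K ≤ K') :
    ∃ c : ℤ, A.symm (Real.sqrt (2 / 3) • (forcedTop z ⟨A, u, 0⟩ n K).nrm -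
      (c : ℝ) • (Real.sqrt (2 / 3) • (forcedTop z ⟨A, u, 0⟩ n K').nrm)) ∈ fccStacking 1 (Real.sqrt (2 / 3)) := by
  induction K', hKK using Nat.le_induction with
  | base => exact ⟨1, by rw [Int.cast_one, one_smul, sub_self]; exact symm_mem_fcc_zero A⟩
  | succ K' hK ih =>
    obtain ⟨c, hc⟩ := ih
    obtain ⟨-, ⟨s, hs⟩⟩ := forcedTop_chain_recursion z A u hn hmenu K'
    refine ⟨c * (3 * s), ?_⟩
    have e : Real.sqrt (2 / 3) • (forcedTop z ⟨A, u, 0⟩ n K).nrm -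
        ((c * (3 * s) : ℤ) : ℝ) • (Real.sqrt (2 / 3) • (forcedTop z ⟨A, u, 0⟩ n (K' + 1)).nrm) =
        (Real.sqrt (2 / 3) • (forcedTop z ⟨A, u, 0⟩ n K).nrm - (c : ℝ) • (Real.sqrt (2 / 3) • (forcedTop z ⟨A, u, 0⟩ n K').nrm)) +
        (c : ℝ) • (Real.sqrt (2 / 3) • (forcedTop z ⟨A, u, 0⟩ n K').nrm -
          ((3 * s : ℤ) : ℝ) • (Real.sqrt (2 / 3) • (forcedTop z ⟨A, u, 0⟩ n (K' + 1)).nrm)) := by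
      push_cast; module
    rw [e]
    exact symm_mem_fcc_add A hc (symm_mem_fcc_zsmul A c hs)

/-- **The reach group lies in the two-chain envelope**: for a slot `u` and a unit menu normal `n₁` of `A` through `A u`, every
`v ∈ reachGroup (chainFrames z A u)` satisfies `v ∈ A·Λ₀ + ℤ g¹_K + ℤ g²_K` for some level `K` (`g²` along the ray of the
second normal `n₂ = 2√(2/3)·A u − n₁`). -/
theorem reachGroup_chainFrames_subset_two_chains (z : EuclideanSpace ℝ (Fin 3))
    (A : EuclideanSpace ℝ (Fin 3) ≃ₗᵢ[ℝ] EuclideanSpace ℝ (Fin 3)) {u n₁ : EuclideanSpace ℝ (Fin 3)} (hu : u ∈ fccSlots)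
    (hn₁ : ‖n₁‖ = 1)
    (hmenu₁ : ∀ w ∈ fccSlots, ⟪A w, n₁⟫_ℝ = 0 ∨ ⟪A w, n₁⟫_ℝ = Real.sqrt (2 / 3) ∨ ⟪A w, n₁⟫_ℝ = -Real.sqrt (2 / 3))
    (hun : ⟪A u, n₁⟫_ℝ = Real.sqrt (2 / 3)) {v : EuclideanSpace ℝ (Fin 3)} (hv : v ∈ reachGroup (chainFrames z A u)) :
    ∃ K : ℕ, ∃ a b : ℤ, A.symm (v - (a : ℝ) • (Real.sqrt (2 / 3) • (forcedTop z ⟨A, u, 0⟩ n₁ K).nrm) -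
      (b : ℝ) • (Real.sqrt (2 / 3) • (forcedTop z ⟨A, u, 0⟩ ((2 * Real.sqrt (2 / 3)) • A u - n₁) K).nrm)) ∈
      fccStacking 1 (Real.sqrt (2 / 3)) := by
  set n₂ : EuclideanSpace ℝ (Fin 3) := (2 * Real.sqrt (2 / 3)) • A u - n₁ with hn₂
  have hn₂u : ‖n₂‖ = 1 := norm_mirror_slot A hn₁ hu hun
  have hmenu₂ : ∀ w ∈ fccSlots, ⟪A w, n₂⟫_ℝ = 0 ∨ ⟪A w, n₂⟫_ℝ = Real.sqrt (2 / 3) ∨ ⟪A w, n₂⟫_ℝ = -Real.sqrt (2 / 3) :=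
    menu_mirror_slot A hmenu₁ hu hun
  have hAu : ‖A u‖ = 1 := by rw [LinearIsometryEquiv.norm_map, norm_eq_one_of_mem_fccSlots hu]
  -- abbreviations for the two rays' DSC vectors
  have lift : ∀ (n : EuclideanSpace ℝ (Fin 3)), ‖n‖ = 1 →
      (∀ w ∈ fccSlots, ⟪A w, n⟫_ℝ = 0 ∨ ⟪A w, n⟫_ℝ = Real.sqrt (2 / 3) ∨ ⟪A w, n⟫_ℝ = -Real.sqrt (2 / 3)) →
      ∀ {K K' : ℕ}, K ≤ K' → ∃ c : ℤ, A.symm (Real.sqrt (2 / 3) • (forcedTop z ⟨A, u, 0⟩ n K).nrm -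
        (c : ℝ) • (Real.sqrt (2 / 3) • (forcedTop z ⟨A, u, 0⟩ n K').nrm)) ∈ fccStacking 1 (Real.sqrt (2 / 3)) :=
    fun n hn hm K K' h => forcedTop_nrm_lift z A u hn hm h
  unfold reachGroup at hv
  induction hv using AddSubgroup.closure_induction with
  | mem v hv =>
    obtain ⟨F, hF, w, hw, rfl⟩ := hv
    rcases hF with rfl | ⟨n, hn, hmenu, hcn, k, rfl⟩
    · refine ⟨0, 0, 0, ?_⟩
      rw [Int.cast_zero, zero_smul, zero_smul, sub_zero, sub_zero, LinearIsometryEquiv.symm_apply_apply]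
      exact mem_fcc_of_mem_fccSlots hw
    · obtain ⟨-, -, -, -, -, h8⟩ := forcedTop_chain_invariant z A u hn hmenu k
      obtain ⟨a, ha⟩ := h8 k le_rfl w (mem_fcc_of_mem_fccSlots hw)
      rcases menu_normal_eq_or_eq_twin A hn₁ hn hAu hmenu₁ hmenu hun hcn with hcase | hcase
      · subst hcase
        refine ⟨k, a, 0, ?_⟩
        rw [Int.cast_zero, zero_smul, sub_zero]; exact ha
      · subst hcase
        refine ⟨k, 0, a, ?_⟩
        rw [Int.cast_zero, zero_smul, sub_zero]; exact ha
  | zero =>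
    refine ⟨0, 0, 0, ?_⟩
    rw [Int.cast_zero, zero_smul, zero_smul, sub_zero, sub_zero]; exact symm_mem_fcc_zero A
  | add v w _ _ hv hw =>
    obtain ⟨K₁, a₁, b₁, h₁⟩ := hv
    obtain ⟨K₂, a₂, b₂, h₂⟩ := hw
    obtain ⟨c₁, hc₁⟩ := lift n₁ hn₁ hmenu₁ (Nat.le_add_right K₁ K₂)
    obtain ⟨d₁, hd₁⟩ := lift n₂ hn₂u hmenu₂ (Nat.le_add_right K₁ K₂)
    obtain ⟨c₂, hc₂⟩ := lift n₁ hn₁ hmenu₁ (Nat.le_add_left K₂ K₁)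
    obtain ⟨d₂, hd₂⟩ := lift n₂ hn₂u hmenu₂ (Nat.le_add_left K₂ K₁)
    refine ⟨K₁ + K₂, a₁ * c₁ + a₂ * c₂, b₁ * d₁ + b₂ * d₂, ?_⟩
    set G₁ := Real.sqrt (2 / 3) • (forcedTop z ⟨A, u, 0⟩ n₁ (K₁ + K₂)).nrm
    set G₂ := Real.sqrt (2 / 3) • (forcedTop z ⟨A, u, 0⟩ n₂ (K₁ + K₂)).nrm
    set p₁ := Real.sqrt (2 / 3) • (forcedTop z ⟨A, u, 0⟩ n₁ K₁).nrm
    set q₁ := Real.sqrt (2 / 3) • (forcedTop z ⟨A, u, 0⟩ n₂ K₁).nrm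
    set p₂ := Real.sqrt (2 / 3) • (forcedTop z ⟨A, u, 0⟩ n₁ K₂).nrm
    set q₂ := Real.sqrt (2 / 3) • (forcedTop z ⟨A, u, 0⟩ n₂ K₂).nrm
    have e : v + w - ((a₁ * c₁ + a₂ * c₂ : ℤ) : ℝ) • G₁ - ((b₁ * d₁ + b₂ * d₂ : ℤ) : ℝ) • G₂ =
        (v - (a₁ : ℝ) • p₁ - (b₁ : ℝ) • q₁) + (w - (a₂ : ℝ) • p₂ - (b₂ : ℝ) • q₂) +
        ((a₁ : ℝ) • (p₁ - (c₁ : ℝ) • G₁) + (b₁ : ℝ) • (q₁ - (d₁ : ℝ) • G₂)) +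
        ((a₂ : ℝ) • (p₂ - (c₂ : ℝ) • G₁) + (b₂ : ℝ) • (q₂ - (d₂ : ℝ) • G₂)) := by
      push_cast; module
    rw [e]
    exact symm_mem_fcc_add A (symm_mem_fcc_add A (symm_mem_fcc_add A h₁ h₂)
      (symm_mem_fcc_add A (symm_mem_fcc_zsmul A a₁ hc₁) (symm_mem_fcc_zsmul A b₁ hd₁)))
      (symm_mem_fcc_add A (symm_mem_fcc_zsmul A a₂ hc₂) (symm_mem_fcc_zsmul A b₂ hd₂))
  | neg v _ hv =>
    obtain ⟨K, a, b, h⟩ := hv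
    refine ⟨K, -a, -b, ?_⟩
    have e : -v - ((-a : ℤ) : ℝ) • (Real.sqrt (2 / 3) • (forcedTop z ⟨A, u, 0⟩ n₁ K).nrm) -
        ((-b : ℤ) : ℝ) • (Real.sqrt (2 / 3) • (forcedTop z ⟨A, u, 0⟩ n₂ K).nrm) =
        ((-1 : ℤ) : ℝ) • (v - (a : ℝ) • (Real.sqrt (2 / 3) • (forcedTop z ⟨A, u, 0⟩ n₁ K).nrm) -
          (b : ℝ) • (Real.sqrt (2 / 3) • (forcedTop z ⟨A, u, 0⟩ n₂ K).nrm)) := by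
      push_cast; module
    rw [e]
    exact symm_mem_fcc_zsmul A (-1) h

/-- **CHAIN TORSION.**  For a slot `u` and a unit menu normal `n₁` of `A` through `A u` (second normal
`n₂ = 2√(2/3)·A u − n₁`): every `v ∈ reachGroup (chainFrames z A u)` with `3v ∈ A·Λ₀` lies in
`A·Λ₀ + ℤ·√(2/3)n₁ + ℤ·√(2/3)n₂` — the level-⅓ part of one grain's reach group is the pair of fault cosets of the two planes
through the steep slot, nothing else. -/
theorem reachGroup_chainFrames_torsion (z : EuclideanSpace ℝ (Fin 3))
    (A : EuclideanSpace ℝ (Fin 3) ≃ₗᵢ[ℝ] EuclideanSpace ℝ (Fin 3)) {u n₁ : EuclideanSpace ℝ (Fin 3)} (hu : u ∈ fccSlots)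
    (hn₁ : ‖n₁‖ = 1)
    (hmenu₁ : ∀ w ∈ fccSlots, ⟪A w, n₁⟫_ℝ = 0 ∨ ⟪A w, n₁⟫_ℝ = Real.sqrt (2 / 3) ∨ ⟪A w, n₁⟫_ℝ = -Real.sqrt (2 / 3))
    (hun : ⟪A u, n₁⟫_ℝ = Real.sqrt (2 / 3)) {v : EuclideanSpace ℝ (Fin 3)} (hv : v ∈ reachGroup (chainFrames z A u))
    (h3 : A.symm ((3 : ℝ) • v) ∈ fccStacking 1 (Real.sqrt (2 / 3))) :
    ∃ a b : ℤ, A.symm (v - (a : ℝ) • (Real.sqrt (2 / 3) • n₁) -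
      (b : ℝ) • (Real.sqrt (2 / 3) • ((2 * Real.sqrt (2 / 3)) • A u - n₁))) ∈ fccStacking 1 (Real.sqrt (2 / 3)) := by
  set n₂ : EuclideanSpace ℝ (Fin 3) := (2 * Real.sqrt (2 / 3)) • A u - n₁ with hn₂
  have hn₂u : ‖n₂‖ = 1 := norm_mirror_slot A hn₁ hu hun
  have hmenu₂ : ∀ w ∈ fccSlots, ⟪A w, n₂⟫_ℝ = 0 ∨ ⟪A w, n₂⟫_ℝ = Real.sqrt (2 / 3) ∨ ⟪A w, n₂⟫_ℝ = -Real.sqrt (2 / 3) :=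
    menu_mirror_slot A hmenu₁ hu hun
  obtain ⟨K, a, b, hK⟩ := reachGroup_chainFrames_subset_two_chains z A hu hn₁ hmenu₁ hun hv
  set G₁ := Real.sqrt (2 / 3) • (forcedTop z ⟨A, u, 0⟩ n₁ K).nrm with hG₁
  set G₂ := Real.sqrt (2 / 3) • (forcedTop z ⟨A, u, 0⟩ n₂ K).nrm with hG₂
  -- `3a G₁ + 3b G₂ = 3v − 3(v − aG₁ − bG₂) ∈ M`
  have h3ab : A.symm (((3 * a : ℤ) : ℝ) • G₁ + ((3 * b : ℤ) : ℝ) • G₂) ∈ fccStacking 1 (Real.sqrt (2 / 3)) := by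
    have e : ((3 * a : ℤ) : ℝ) • G₁ + ((3 * b : ℤ) : ℝ) • G₂ =
        (3 : ℝ) • v - ((3 : ℤ) : ℝ) • (v - (a : ℝ) • G₁ - (b : ℝ) • G₂) := by push_cast; module
    rw [e]; exact symm_mem_fcc_sub A h3 (symm_mem_fcc_zsmul A 3 hK)
  obtain ⟨ha, hb⟩ := two_chain_torsion z A hu hn₁ hmenu₁ hun K _ _ h3ab
  rw [pow_succ, mul_comm ((3 : ℤ) ^ K) 3] at ha hb
  have ha' : ((3 : ℤ) ^ K) ∣ a := (mul_dvd_mul_iff_left (by norm_num : (3 : ℤ) ≠ 0)).1 ha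
  have hb' : ((3 : ℤ) ^ K) ∣ b := (mul_dvd_mul_iff_left (by norm_num : (3 : ℤ) ≠ 0)).1 hb
  obtain ⟨a', rfl⟩ := ha'
  obtain ⟨b', rfl⟩ := hb'
  -- `3^K Gᵢ ≡ wᵢ gᵢ_0`
  obtain ⟨-, -, -, ⟨w₁, -, hw₁⟩, -⟩ := forcedTop_chain_invariant z A u hn₁ hmenu₁ K
  obtain ⟨-, -, -, ⟨w₂, -, hw₂⟩, -⟩ := forcedTop_chain_invariant z A u hn₂u hmenu₂ K
  refine ⟨a' * w₁, b' * w₂, ?_⟩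
  have e0₁ : (forcedTop z ⟨A, u, 0⟩ n₁ 0).nrm = n₁ := rfl
  have e0₂ : (forcedTop z ⟨A, u, 0⟩ n₂ 0).nrm = n₂ := rfl
  have e : v - ((a' * w₁ : ℤ) : ℝ) • (Real.sqrt (2 / 3) • n₁) - ((b' * w₂ : ℤ) : ℝ) • (Real.sqrt (2 / 3) • n₂) =
      (v - ((3 ^ K * a' : ℤ) : ℝ) • G₁ - ((3 ^ K * b' : ℤ) : ℝ) • G₂) +
      ((a' : ℝ) • (((3 : ℝ) ^ K) • G₁ - (w₁ : ℝ) • (Real.sqrt (2 / 3) • n₁)) +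
        (b' : ℝ) • (((3 : ℝ) ^ K) • G₂ - (w₂ : ℝ) • (Real.sqrt (2 / 3) • n₂))) := by
    push_cast; module
  rw [e]
  exact symm_mem_fcc_add A hK (symm_mem_fcc_add A (symm_mem_fcc_zsmul A a' hw₁) (symm_mem_fcc_zsmul A b' hw₂))

end Summit.Ventures.Crystal3D.Theorems

end
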